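import Literature.MathematicalPhysics.QuantumFieldTheory.Balaban1983to89.B5DPD126Uniform

/-!
# Bałaban 1984 (Propagators & RT I), (1.127): the HÖLDER estimate for the kernel of `∂P∂^*`, with constants depending
# on `d` and `α` only — the `k`-UNIFORM, VOLUME-UNIFORM statement, certified in the `U = 1` torus multiplier model

CITATION HEADER.  T. Bałaban, *Propagators and renormalization transformations for lattice gauge theories. I*,
Commun. Math. Phys. **95** (1984) 17–40 (`Balaban1984PropagatorsI`, B5), §E p. 38; T. Bałaban, *Regularity and decay of
lattice Green's functions*, Commun. Math. Phys. **89** (1983) 571–597 (`Balaban1983RegularityDecay`, B4), Lemma 2.4 (2.36)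
p. 582 with (2.49)–(2.51) pp. 585–586.  This file is a SUPPLEMENT written by the audit, NOT a quotation: B5 states (1.127)
and says only where it comes from; no proof is printed.  Journal page = PDF page + 16 for B5.

THE PRINTED TEXT (B5 p. 38, verbatim from the page image).  After «Let us write bounds for the operator ∂P∂*. They follow
from the representation P = G′Q′*(Q′G′²Q′*)⁻¹Q′G′, from Lemma 2.4 of [2], and the representation (1.45) and the analyticity
method of proving an exponential decay (see the proof of Lemma 2.4 in [2]). We obtain» and (1.126), the paper prints
  «(1/|x − x′|^α) |(∂P∂*)_{μ,ν}(x, x″) − (∂P∂*)_{μ,ν}(x′, x″)| ≦ O(1)e^{−δ′₀|x−x″|}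
                                                               for x, x′: |x − x′| ≦ 1, α < 1.   (1.127)»
«The constant O(1) in (1.126) depends on d only, and in (1.127) it depends on α also (O(1) → ∞ if α → 1).»
The kernel convention is (1.120), p. 37 («(∂P∂*hA)_μ(x) = Σ_{x′,ν} η^d(∂P∂*)_{μν}(x, x′)h(x′)A_ν(x′)», `η`-weighted measure);
`[2]` = B4, whose Lemma 2.4 (2.36) p. 582 is the Hölder estimate «(1/|x − x′|^α)|(∂^{L^{−j}}_μ G_j(□)Q_j^*)(x, y) −
(∂^{L^{−j}}_μ G_j(□)Q_j^*)(x′, y)| ≦ c₁e^{−δ₀dist({x,x′},y)}» for the factor `∂G′Q′^*` (typed on the torus by b04's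
`B4StripSumsHolder`: multiplier `GH`, torus kernel `torusKernelH248`, uniform decay `hkernel248_torusKernel_decay_torusMetric`,
whose constant is finite exactly for `α < 1`).

VERSION.  v1 = resubmission of the first text (p183512, bounced `dedup.landed`: its copy of `translate_add_right` restated
b04's `B4TorusPositivity.translate_add_right`, which is now used BY NAME); relative to that text also the B4 (2.36) quotation above
is restored to the printed fraction form `1/|x − x′|^α` with `≦` (p. 582) and the B4 (2.49) phase factor is quoted as printed
(pv17-g8 pre-landing XREAD of the first text, GAPS C-pv17-55, remarks R1/R2); no other declaration changed.

WHAT THE CELL ALREADY HAS.  `B5DPD126Uniform` (this lineage, node 1) fixes the `U = 1`, `m² = 0` torus multiplier model of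
b05-g7 (`n = L^k = η⁻¹` fine points per unit block, period vector `N`, fine torus `Π_μ Fin (nN_μ)`, unit torus `Π_μ Fin N_μ`,
`a ∈ [a₋,a₊]`, `0 < a₋`), the factor matrix `DKRe μ` = `∂^η_μ(G′_kQ′_k^*)` (fine × coarse; `DKRe_eq`: its entry is b04's
differentiated torus kernel `torusKernelD248`), the `η`-weighted kernel `dpd n a N μ ν = DKRe μ · kerRe · (DKRe ν)ᵀ` of
`∂_μ P ∂_ν^*` ((1.120); `Dmat_matrixP_Dmat_transpose`), the two uniform factor bounds `DKRe_decay`, `kerRe_decay`, the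
uniform torus convolution estimate `conv_decay`, and (1.126) with constants `d, a₋, a₊` only (`dpd_decay_uniform`).

THIS FILE supplies (1.127) in the same model, by the same composition with the first factor replaced by its HÖLDER
QUOTIENT in the fine (row) variable.  §1 proves the symbol identity behind it: with `PhZ_k(σ)(p′) = e^{i(p′+2πk)·σ/n}`
(`B4StripSumsHolder.PhZ`, multiplicative in `σ`: `PhZ_add`),
  `n·(Gfull(z+σ+e_μ; p′) − Gfull(z+σ; p′)) = e^{ip′·⌊z/n⌋}·Σ_k PhZ_k(σ)(p′)·termD_k(z mod n)(p′)`  (`Gfull_shift_fdiff`),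
hence `(n/|σ|_∞)^α·[n(Gfull(z+σ+e_μ) − Gfull(z+σ)) − n(Gfull(z+e_μ) − Gfull(z))] = e^{ip′·⌊z/n⌋}·GH_{α,n,a,m²,z mod n,μ,σ}(p′)`
(`Gfull_hdiff`; `GH = (n/|σ|_∞)^α Σ_k (PhZ_k(σ) − 1)·termD_k`, b04's regrouping of B4 (2.49)) and, on the torus,
  `(n/|σ|_∞)^α·[n(K_T(z+σ+e_μ,y) − K_T(z+σ,y)) − n(K_T(z+e_μ,y) − K_T(z,y))]
       = torusKernelH248 α n a m² (z mod n) μ σ N (⌊z/n⌋ − y)`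
(`KT_hdiff`): the `|x−x′|^{−α}`-weighted difference of the differentiated factor kernel at the fine points `z+σ` and `z`
IS b04's torus Hölder-quotient kernel.  §2 defines the fine-torus translate `tsh σ x = x + σ (mod nN)` and the real matrix
  `HDKRe α μ σ (x,k) := (n/|σ|_∞)^α·(DKRe μ (x+σ, k) − DKRe μ (x, k))`  (fine × coarse),
identifies its entry with `Re torusKernelH248 …` (`HDKRe_eq`, periodicity `KT_translate_left`) and reads off the UNIFORM decay
`|HDKRe| ≤ M·periodConst κ d·e^{−(κ/(d+1))|⌊x/n⌋ − k|_{T₁}}` with `κ, M` depending on `d, α, a₋, a₊` only (`HDKRe_decay`).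
§3 is the algebra `(n/|σ|_∞)^α·(dpd(x+σ, x″) − dpd(x, x″)) = (HDKRe α μ σ · kerRe · (DKRe ν)ᵀ)(x, x″)` (`holderQuot_dpd_eq`) and
the HEADLINE `dpd_holder_uniform`: for `0 < a₋ ≤ a₊` and `0 ≤ α < 1` there are `δ > 0`, `C ≥ 0` depending on `d, α, a₋, a₊`
ONLY such that for every `n = L^k ≥ 1`, `a ∈ [a₋,a₊]`, every period vector (`N_μ ≥ 1`), all `μ, ν`, every separation
numerator `σ ∈ ℤ^{d+1}`, `σ ≠ 0`, `|σ_i| ≤ n` (i.e. `0 < |x − x′|_∞ = |σ|_∞/n ≤ 1`) and all fine points `x, x″`,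
  `(n/|σ|_∞)^α · |dpd n a N μ ν (x+σ) x″ − dpd n a N μ ν x x″| ≤ C · e^{−δ·|⌊x/n⌋ − ⌊x″/n⌋|_{T₁}}`,
with the fine-distance form `≤ C′·e^{−(δ/n)·tdist_{T_η}(x,x″)}` (`dpd_holder_uniform_fine`) and the torus-kernel dictionary
`torusKernelH248 = (n/|σ|_∞)^α·(torusKernelD248(offset, block of z+σ) − torusKernelD248(offset, block of z))`
(`torusKernelH248_eq_sub`).  This is the content of «in (1.127) it depends on α also» in the model: the constants see `d`, `α`
(and the admissible `a`-interval), NOT `k` (through `n = L^k`) nor the volume; b04's majorant `boundGH d α c m²₊ ∝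
(48·ζ(s_H(α,d)))^{d+1}`, `s_H(α,d) = 1 + (1−α)/(d+1) ↓ 1`, diverges as `α → 1` — matching «(O(1) → ∞ if α → 1)»; no constant
is produced for `α ≥ 1`.

DICTIONARY WITH THE PRINTED (1.127).  Fine torus points `x, x′ = x + ησ, x″ ∈ T_η` (`η = 1/n`); `|x − x′| = η|σ|_∞ ∈ (0, 1]`
is exactly the printed side condition «|x − x′| ≦ 1» (sup-metric; the paper states (1.127) for `|x − x′| ≦ 1` only and so
does this file: `σ ≠ 0`, `|σ_i| ≤ n`, `separation_mem_Ioc`); `1/|x − x′|^α = (n/|σ|_∞)^α`; the roles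
of `x` and `x′` in the difference are exchanged relative to the print, which changes the quotient by a sign only; `|x − x″|` of
the exponent is the torus distance, measured here in blocks (`|⌊x/n⌋ − ⌊x″/n⌋|_{T₁}`, headline) or in fine steps times `η`
(`_fine`), the two differing by at most `1` — absorbed in `C`.

HONEST SCOPE.  Covered: (1.127) for `U = 1`, `m² = 0`, on the torus, `η`-weighted kernel (1.120), sup-metric, Hölder
quotient in the FIRST variable (the printed one), every `k ≥ 0`, every volume, every `0 ≤ α < 1`, constants `d, α, a₋, a₊`
only.  NOT covered: external gauge fields `U ≠ 1` (no Fourier analysis); the `ℓ²`/operator-norm forms; a Hölder quotient in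
the second variable (by the symmetry `dpd μ ν (x,x″) = dpd ν μ (x″,x)` of the model it is the same statement, not spelled
out).  Value = kernel certificate of a printed by-reference claim in an explicit model — NOT summit progress.

TAGS: `[cite: Balaban1984PropagatorsI, …]` on the decls that formalise the printed display (1.127) and its sentence,
`[cite: Balaban1983RegularityDecay, …]` on the B4 Lemma 2.4 (2.36) inputs, `[folklore]` on phase algebra and index
bookkeeping.  This module imports `B5DPD126Uniform` (b05-g8) only (b04's `B4StripSumsHolder` is in its import closure).
-/

namespace Literature.MathematicalPhysics.QuantumFieldTheory.Balaban1983to89.B5DPD127HolderUniform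

open Complex Finset UnitAddTorus
open Literature.MathematicalPhysics.QuantumFieldTheory.Balaban1983to89.B4Strip
open Literature.MathematicalPhysics.QuantumFieldTheory.Balaban1983to89.B4ContourShift
open Literature.MathematicalPhysics.QuantumFieldTheory.Balaban1983to89.B4StripSums
open Literature.MathematicalPhysics.QuantumFieldTheory.Balaban1983to89.B4StripSumsHolder
open Literature.MathematicalPhysics.QuantumFieldTheory.Balaban1983to89.B4StripSumsDeriv
open Literature.MathematicalPhysics.QuantumFieldTheory.Balaban1983to89.B4TorusKernel
open Literature.MathematicalPhysics.QuantumFieldTheory.Balaban1983to89.B4Torus248Decay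
open Literature.MathematicalPhysics.QuantumFieldTheory.Balaban1983to89.B4Green244
open Literature.MathematicalPhysics.QuantumFieldTheory.Balaban1983to89.B4TorusGreen244
open Literature.MathematicalPhysics.QuantumFieldTheory.Balaban1983to89.B4Sect5Torus
open Literature.MathematicalPhysics.QuantumFieldTheory.Balaban1983to89.B5Torus145Decay
open Literature.MathematicalPhysics.QuantumFieldTheory.Balaban1983to89.B5QGGQ145Torus
open Literature.MathematicalPhysics.QuantumFieldTheory.Balaban1983to89.B5QGGQ145Bounds
open Literature.MathematicalPhysics.QuantumFieldTheory.Balaban1983to89.B5QGGQ145Factor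
open Literature.MathematicalPhysics.QuantumFieldTheory.Balaban1983to89.B5DPD126Uniform
open scoped Real Matrix

noncomputable section

variable {d : ℕ}

/-! ### §1 The symbol identity for the Hölder quotient of `∂_μ(G′Q′^*)` in the fine variable -/

/-- one coordinate of the fine-point phase is additive in the fine coordinate: `e^{i(ζ+2πj)(s+t)/n} = e^{…s/n}e^{…t/n}`.
[folklore] -/
theorem efZ_add (n j : ℕ) (s t : ℤ) (ζ : ℂ) : efZ n j (s + t) ζ = efZ n j s ζ * efZ n j t ζ := by
  unfold efZ
  rw [← Complex.exp_add]
  congr 1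
  push_cast
  ring

/-- the fine-point phase is multiplicative: `PhZ_k(z + w) = PhZ_k(z)·PhZ_k(w)` (`e^{i(p′+2πk)·(z+w)/n}`). [folklore] -/
theorem PhZ_add (n : ℕ) (k : Fin d → Fin n) (z w : Fin d → ℤ) (P : Fin d → ℂ) :
    PhZ n k (z + w) P = PhZ n k z P * PhZ n k w P := by
  unfold PhZ
  rw [← Finset.prod_mul_distrib]
  exact Finset.prod_congr rfl fun ν _ => by rw [Pi.add_apply, efZ_add]

/-- **FORWARD DIFFERENCE OF THE FULL MULTIPLIER AT A SHIFTED FINE POINT**: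
`n·(Gfull(z+σ+e_μ; p′) − Gfull(z+σ; p′)) = e^{ip′·⌊z/n⌋}·Σ_k PhZ_k(σ)(p′)·termD_k(z mod n)(p′)` — relative to the base point `z`
the shift by `σ` fine steps multiplies the `k`-th term of b04's differentiated multiplier by the phase `e^{i(p′+2πk)·σ/n}`
(the phase `e^{i(p′+l)·(x−x′)}` inside the first factor «(e^{i(p′+l)·(x−x′)} − 1)e^{i(p′+l)(x′−y)}» of B4 (2.49), p. 585 —
there `x′` is the base point and `x` the shifted one; here the base point is `z/n` and the shifted point `(z+σ)/n`).
[cite: Balaban1983RegularityDecay, (2.49) p.585 with p.573 (difference derivative);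
proof supplied by the audit] -/
theorem Gfull_shift_fdiff (n : ℕ) [NeZero n] (a m2 : ℝ) (z σ : Fin (d + 1) → ℤ) (μ : Fin (d + 1))
    (P : Fin (d + 1) → ℂ) :
    (n : ℂ) * (Gfull n a m2 (z + σ + e μ) P - Gfull n a m2 (z + σ) P)
      = cexp (I * phaseC P (coarse n z)) * ∑ k : Fin (d + 1) → Fin n, PhZ n k σ P * termD n a m2 (offset n z) μ k P := by
  have hPh : ∀ k : Fin (d + 1) → Fin n,
      PhZ n k z P = cexp (I * phaseC P (coarse n z)) * ∏ ν, ef n (k ν : ℕ) ((offset n z ν : ℕ)) (P ν) := by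
    intro k
    conv_lhs => rw [← finePt_coarse_offset n z]
    exact PhZ_finePt n (NeZero.ne n) k (coarse n z) (offset n z) P
  unfold Gfull termD D term F V
  rw [← Finset.sum_sub_distrib, Finset.mul_sum, Finset.mul_sum]
  refine Finset.sum_congr rfl fun k _ => ?_
  have hexp : cexp (I * ((P μ + 2 * π * ((k μ : ℕ) : ℂ)) / n)) = cexp (I * (P μ + 2 * π * ((k μ : ℕ) : ℂ)) / n) := by
    congr 1; ring
  rw [PhZ_add_e, PhZ_add, hPh k, Finset.prod_mul_distrib, hexp]
  ring

/-- **THE HÖLDER QUOTIENT OF THE FULL DIFFERENTIATED MULTIPLIER IS b04's `GH`**: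
`(n/|σ|_∞)^α·[n(Gfull(z+σ+e_μ) − Gfull(z+σ)) − n(Gfull(z+e_μ) − Gfull(z))] = e^{ip′·⌊z/n⌋}·GH_{α,n,a,m²,z mod n,μ,σ}(p′)`.
[cite: Balaban1983RegularityDecay, (2.36) p.582 with (2.49) p.585 (regrouped by the audit); proof supplied by the audit] -/
theorem Gfull_hdiff (α : ℝ) (n : ℕ) [NeZero n] (a m2 : ℝ) (z σ : Fin (d + 1) → ℤ) (μ : Fin (d + 1))
    (P : Fin (d + 1) → ℂ) :
    ((((n : ℝ) / supNorm σ) ^ α : ℝ) : ℂ) *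
        ((n : ℂ) * (Gfull n a m2 (z + σ + e μ) P - Gfull n a m2 (z + σ) P)
          - (n : ℂ) * (Gfull n a m2 (z + e μ) P - Gfull n a m2 z P))
      = cexp (I * phaseC P (coarse n z)) * GH α n a m2 (offset n z) μ σ P := by
  rw [Gfull_shift_fdiff, Gfull_fdiff]
  unfold GH GD termH
  simp only [sub_mul, one_mul, Finset.sum_sub_distrib]
  ring

/-- **THE HÖLDER QUOTIENT OF `∂^η_μ K_T` IN THE FINE POINT IS b04's TORUS HÖLDER-QUOTIENT KERNEL**:
`(n/|σ|_∞)^α·[n(K_T(z+σ+e_μ,y) − K_T(z+σ,y)) − n(K_T(z+e_μ,y) − K_T(z,y))]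
   = torusKernelH248 α n a m² (z mod n) μ σ N (⌊z/n⌋ − y)`
— B4 Lemma 2.4 (2.36) (the Hölder quotient of `∂^ξ_μ G_jQ_j^*` in the first variable) read on the torus at the fine points
`z + σ`, `z` (`|x′ − x|_∞ = |σ|_∞/n`).  [cite: Balaban1983RegularityDecay, Lemma 2.4 (2.36) p.582 with (2.49) p.585 and p.572
(torus); Balaban1984PropagatorsI (1.127) p.38 "from Lemma 2.4 of [2]"; proof supplied by the audit] -/
theorem KT_hdiff (α : ℝ) (n : ℕ) [NeZero n] (a m2 : ℝ) (N : Fin (d + 1) → ℕ) (z y σ : Fin (d + 1) → ℤ)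
    (μ : Fin (d + 1)) :
    ((((n : ℝ) / supNorm σ) ^ α : ℝ) : ℂ) *
        ((n : ℂ) * (KT n a m2 N (z + σ + e μ) y - KT n a m2 N (z + σ) y)
          - (n : ℂ) * (KT n a m2 N (z + e μ) y - KT n a m2 N z y))
      = torusKernelH248 α n a m2 (offset n z) μ σ N (coarse n z - y) := by
  rw [KT_eq_sum, KT_eq_sum, KT_eq_sum, KT_eq_sum, ← Finset.sum_sub_distrib, ← Finset.sum_sub_distrib, Finset.mul_sum,
    Finset.mul_sum, ← Finset.sum_sub_distrib, Finset.mul_sum]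
  unfold torusKernelH248
  rw [Finset.mul_sum]
  refine Finset.sum_congr rfl fun k _ => ?_
  set Pk : Fin (d + 1) → ℂ := ofRealVec (dualMomentum N k) with hPk
  set cf : ℂ := (∏ i, ((N i : ℕ) : ℂ))⁻¹ * cexp (-(I * phaseC Pk y)) with hcf
  have hG := Gfull_hdiff α n a m2 z σ μ Pk
  have hdm : (fun i => 2 * π * rep (MultiPeriod.gridPt N k i)) = dualMomentum N k := rfl
  have hL : ((((n : ℝ) / supNorm σ) ^ α : ℝ) : ℂ) *
      ((n : ℂ) * (cf * Gfull n a m2 (z + σ + e μ) Pk - cf * Gfull n a m2 (z + σ) Pk)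
        - (n : ℂ) * (cf * Gfull n a m2 (z + e μ) Pk - cf * Gfull n a m2 z Pk))
      = cf * (((((n : ℝ) / supNorm σ) ^ α : ℝ) : ℂ) *
        ((n : ℂ) * (Gfull n a m2 (z + σ + e μ) Pk - Gfull n a m2 (z + σ) Pk)
          - (n : ℂ) * (Gfull n a m2 (z + e μ) Pk - Gfull n a m2 z Pk))) := by ring
  rw [hL, hG, hdm, mFourier_gridPt, ← hPk, phaseC_sub, mul_sub, Complex.exp_sub, hcf, Complex.exp_neg, div_eq_mul_inv]
  ring

/-- **DICTIONARY AT THE LEVEL OF TORUS KERNELS**: b04's torus Hölder-quotient kernel is the `(n/|σ|_∞)^α`-weighted difference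
of its differentiated torus kernels at the offsets and blocks of `z + σ` and of `z`:
`torusKernelH248 α … (z mod n) μ σ N (⌊z/n⌋ − y) = (n/|σ|_∞)^α·(torusKernelD248 … ((z+σ) mod n) μ N (⌊(z+σ)/n⌋ − y) −
torusKernelD248 … (z mod n) μ N (⌊z/n⌋ − y))`.  [folklore] -/
theorem torusKernelH248_eq_sub (α : ℝ) (n : ℕ) [NeZero n] (a m2 : ℝ) (N : Fin (d + 1) → ℕ) (z y σ : Fin (d + 1) → ℤ)
    (μ : Fin (d + 1)) :
    torusKernelH248 α n a m2 (offset n z) μ σ N (coarse n z - y)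
      = ((((n : ℝ) / supNorm σ) ^ α : ℝ) : ℂ) *
        (torusKernelD248 n a m2 (offset n (z + σ)) μ N (coarse n (z + σ) - y)
          - torusKernelD248 n a m2 (offset n z) μ N (coarse n z - y)) := by
  rw [← KT_hdiff, ← KT_fdiff, ← KT_fdiff]

/-! ### §2 The Hölder quotient of the factor `∂_μ(G′Q′^*)` as a real matrix and its uniform decay -/

/-- the translate `x + σ` on the discrete torus `Π_i ℤ/P_i` (coordinatewise reduction mod `P_i`). [folklore] -/
def tsh {P : Fin (d + 1) → ℕ} (σ : Fin (d + 1) → ℤ) (x : Idx P) : Idx P := fun i =>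
  ⟨((toZ x i + σ i) % (P i : ℤ)).toNat, by
    have hP : (0 : ℤ) < (P i : ℤ) := by exact_mod_cast Fin.pos (x i)
    have h0 := Int.emod_nonneg (toZ x i + σ i) hP.ne'
    have h1 := Int.emod_lt_of_pos (toZ x i + σ i) hP
    generalize (toZ x i + σ i) % (P i : ℤ) = t at h0 h1 ⊢
    omega⟩

/-- the representative of the translate is a period-translate of `toZ x + σ`. [folklore] -/
theorem toZ_tsh {P : Fin (d + 1) → ℕ} (σ : Fin (d + 1) → ℤ) (x : Idx P) :
    toZ (tsh σ x) = MultiPeriod.translate P (toZ x + σ) (fun i => -((toZ x + σ) i / (P i : ℤ))) := by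
  funext i
  have hP : (0 : ℤ) < (P i : ℤ) := by exact_mod_cast Fin.pos (x i)
  rw [MultiPeriod.translate_apply, Pi.add_apply]
  simp only [B5QGGQ145Bounds.toZ, tsh, Fin.val_mk]
  rw [Int.toNat_of_nonneg (Int.emod_nonneg _ hP.ne'), Int.emod_def]
  ring

/-- the entry of `DKRe μ` at the translated row `x + σ` is the forward difference of `Re K_T` at the (unreduced) fine point
`toZ x + σ` (periodicity of `K_T(·,k)` on the fine torus). [folklore] -/
theorem DKRe_tsh (n : ℕ) [NeZero n] (a : ℝ) {N : Fin (d + 1) → ℕ} (hN : ∀ i, 1 ≤ N i) (μ : Fin (d + 1))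
    (σ : Fin (d + 1) → ℤ) (x : Idx (fun i => n * N i)) (k : Idx N) :
    DKRe n a N μ (tsh σ x) k
      = n * ((KT n a 0 N (toZ x + σ + e μ) (toZ k)).re - (KT n a 0 N (toZ x + σ) (toZ k)).re) := by
  simp only [DKRe, Matrix.of_apply]
  rw [toZ_tsh σ x, B4TorusPositivity.translate_add_right, KT_translate_left n a 0 hN, KT_translate_left n a 0 hN]

/-- **THE HÖLDER QUOTIENT OF THE FACTOR `∂^η_μ(G′_kQ′_k^*)` IN THE FINE (ROW) VARIABLE, AS A REAL MATRIX** (fine × coarse):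
entry `(n/|σ|_∞)^α·(DKRe μ (x + σ, k) − DKRe μ (x, k))` = `|x′ − x|^{−α}[(∂_μG′Q′^*)(x′,k) − (∂_μG′Q′^*)(x,k)]`,
`x′ = x + ησ`.
[cite: Balaban1983RegularityDecay, Lemma 2.4 (2.36) p.582 (the quantity estimated); Balaban1984PropagatorsI (1.127) p.38
"from Lemma 2.4 of [2]"] -/
def HDKRe (α : ℝ) (n : ℕ) [NeZero n] (a : ℝ) (N : Fin (d + 1) → ℕ) (μ : Fin (d + 1)) (σ : Fin (d + 1) → ℤ) :
    Matrix (Idx (fun i => n * N i)) (Idx N) ℝ :=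
  Matrix.of fun x k => ((n : ℝ) / supNorm σ) ^ α * (DKRe n a N μ (tsh σ x) k - DKRe n a N μ x k)

/-- the entry of `HDKRe α μ σ` IS (the real part of) b04's torus Hölder-quotient kernel at the offset and block of the row.
[folklore] -/
theorem HDKRe_eq (α : ℝ) (n : ℕ) [NeZero n] (a : ℝ) {N : Fin (d + 1) → ℕ} (hN : ∀ i, 1 ≤ N i) (μ : Fin (d + 1))
    (σ : Fin (d + 1) → ℤ) (x : Idx (fun i => n * N i)) (k : Idx N) :
    HDKRe α n a N μ σ x k
      = (torusKernelH248 α n a 0 (offset n (toZ x)) μ σ N (coarse n (toZ x) - toZ k)).re := by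
  rw [← KT_hdiff α n a 0 N (toZ x) (toZ k) σ μ]
  simp only [HDKRe, Matrix.of_apply]
  rw [DKRe_tsh n a hN]
  simp only [DKRe, Matrix.of_apply]
  rw [show (n : ℂ) = ((n : ℝ) : ℂ) from (Complex.ofReal_natCast n).symm, Complex.re_ofReal_mul, Complex.sub_re,
    Complex.re_ofReal_mul, Complex.re_ofReal_mul, Complex.sub_re, Complex.sub_re]

/-- **B4 LEMMA 2.4 (2.36) FOR THE FACTOR, UNIFORMLY IN `k`, THE OFFSET, THE DIRECTION, THE SEPARATION AND THE VOLUME** —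
b04's `hkernel248_torusKernel_decay_torusMetric` at `m² = 0` read on `HDKRe`: for `0 < a₋ ≤ a₊` and `0 ≤ α < 1` there are
`κ > 0`, `M ≥ 0` (depending on `d, α, a₋, a₊` only; b04's majorant carries `ζ(1 + (1−α)/(d+1))^{d+1}`, divergent as
`α → 1`, and nothing is produced for `α ≥ 1`) with
`|HDKRe α μ σ (x,k)| ≤ M·periodConst κ d·e^{−(κ/(d+1))·|⌊x/n⌋ − k|_{T₁}}` for every `n ≥ 1`, `a ∈ [a₋,a₊]`, `N` (`N_i ≥ 1`),
`μ`, `σ ≠ 0` with `|σ_i| ≤ n`, `x`, `k`.  [cite: Balaban1983RegularityDecay, Lemma 2.4 (2.36) p.582 «for α < 1, there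
exists a constant c₁»; Balaban1984PropagatorsI p.38 "from Lemma 2.4 of [2]"] -/
theorem HDKRe_decay (d : ℕ) (aminus aplus : ℝ) (ha : 0 < aminus) {α : ℝ} (hα0 : 0 ≤ α) (hα1 : α < 1) :
    ∃ κ M : ℝ, 0 < κ ∧ 0 ≤ M ∧ ∀ (n : ℕ) [NeZero n] (a : ℝ), aminus ≤ a → a ≤ aplus →
      ∀ (N : Fin (d + 1) → ℕ), (∀ i, 1 ≤ N i) → ∀ (μ : Fin (d + 1)) (σ : Fin (d + 1) → ℤ), σ ≠ 0 →
        (∀ i, |σ i| ≤ n) → ∀ (x : Idx (fun i => n * N i)) (k : Idx N),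
          |HDKRe α n a N μ σ x k| ≤ M * periodConst κ d *
            Real.exp (-(κ / (d + 1) * MultiPeriod.torusSupNorm N (coarse n (toZ x) - toZ k))) := by
  obtain ⟨κ, M, hκ, hM, h⟩ := hkernel248_torusKernel_decay_torusMetric d aminus aplus 0 ha hα0 hα1
  refine ⟨κ, M, hκ, hM, fun n _ a ha1 ha2 N hN μ σ hσ0 hσn x k => ?_⟩
  rw [HDKRe_eq α n a hN]
  exact (Complex.abs_re_le_norm _).trans
    (h n a 0 ha1 ha2 le_rfl le_rfl (offset n (toZ x)) μ σ hσ0 hσn N hN (coarse n (toZ x) - toZ k))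

/-! ### §3 The Hölder quotient of `(∂P∂^*)_{μν}` and the headline -/

/-- the row `x + σ` of `dpd μ ν` is the row `x` of `(DKRe μ ∘ tsh σ) · kerRe · (DKRe ν)ᵀ` (only the first factor sees the
row index). [folklore] -/
theorem dpd_tsh (n : ℕ) [NeZero n] (a : ℝ) (N : Fin (d + 1) → ℕ) (μ ν : Fin (d + 1)) (σ : Fin (d + 1) → ℤ)
    (x x'' : Idx (fun i => n * N i)) :
    dpd n a N μ ν (tsh σ x) x''
      = ((DKRe n a N μ).submatrix (tsh σ) id * kerRe n a N * (DKRe n a N ν)ᵀ) x x'' := by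
  simp only [dpd, Matrix.mul_apply, Matrix.submatrix_apply, id]

/-- **THE HÖLDER QUOTIENT OF THE `η`-WEIGHTED KERNEL OF `∂_μ P ∂_ν^*` IS A THREE-FACTOR COMPOSITION OVER THE UNIT TORUS**:
`(n/|σ|_∞)^α·(dpd(x+σ, x″) − dpd(x, x″)) = (HDKRe α μ σ · kerRe · (DKRe ν)ᵀ)(x, x″)`.  [cite: Balaban1984PropagatorsI,
p.38 ll.7–10 (the representation `P = G′Q′*(Q′G′²Q′*)⁻¹Q′G′` behind (1.126)–(1.127)); proof supplied by the audit] -/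
theorem holderQuot_dpd_eq (α : ℝ) (n : ℕ) [NeZero n] (a : ℝ) (N : Fin (d + 1) → ℕ) (μ ν : Fin (d + 1))
    (σ : Fin (d + 1) → ℤ) (x x'' : Idx (fun i => n * N i)) :
    ((n : ℝ) / supNorm σ) ^ α * (dpd n a N μ ν (tsh σ x) x'' - dpd n a N μ ν x x'')
      = (HDKRe α n a N μ σ * kerRe n a N * (DKRe n a N ν)ᵀ) x x'' := by
  have hH : HDKRe α n a N μ σ
      = (((n : ℝ) / supNorm σ) ^ α) • ((DKRe n a N μ).submatrix (tsh σ) id - DKRe n a N μ) := by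
    ext y k
    simp only [HDKRe, Matrix.of_apply, Matrix.smul_apply, Matrix.sub_apply, Matrix.submatrix_apply, id, smul_eq_mul]
  rw [hH, Matrix.smul_mul, Matrix.smul_mul, Matrix.sub_mul, Matrix.sub_mul, Matrix.smul_apply, Matrix.sub_apply,
    smul_eq_mul, dpd_tsh]
  rfl

/-- **HEADLINE — (1.126)'s HÖLDER COMPANION (1.127) WITH CONSTANTS DEPENDING ON `d` AND `α` ONLY, IN THE `U = 1` TORUS
MULTIPLIER MODEL.**  For `0 < a₋ ≤ a₊` and `0 ≤ α < 1` there are `δ > 0` and `C ≥ 0` — depending on `d, α, a₋, a₊` and on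
nothing else — such that for EVERY `n = L^k ≥ 1` (every `k`), every `a ∈ [a₋, a₊]`, every period vector (`N_μ ≥ 1`, every
volume), all directions `μ, ν`, every separation numerator `σ ∈ ℤ^{d+1}` with `σ ≠ 0`, `|σ_i| ≤ n` (`0 < |x − x′| = |σ|_∞/n ≤ 1`)
and all fine torus points `x, x″`:
  `(n/|σ|_∞)^α · |dpd n a N μ ν (x+σ) x″ − dpd n a N μ ν x x″| ≤ C · e^{−δ·|⌊x/n⌋ − ⌊x″/n⌋|_{T₁}}`
(torus sup-distance between the blocks of `x` and `x″`; fine-distance form `dpd_holder_uniform_fine`).  Inputs: `HDKRe_decay`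
(B4 Lemma 2.4 (2.36) on the torus), `kerRe_decay` ((1.45) inverse), `DKRe_decay` (B4 Lemma 2.4 (2.35)), `conv_decay` twice.
[cite: Balaban1984PropagatorsI, (1.127) p.38 with p.38 «The constant O(1) in (1.126) depends on d only, and in (1.127) it
depends on α also (O(1) → ∞ if α → 1)»; proof supplied by the audit (composition over the unit torus), the printed route
being "Lemma 2.4 of [2], the representation (1.45) and the analyticity method"] -/
theorem dpd_holder_uniform (d : ℕ) (aminus aplus : ℝ) (ha : 0 < aminus) {α : ℝ} (hα0 : 0 ≤ α) (hα1 : α < 1) :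
    ∃ δ C : ℝ, 0 < δ ∧ 0 ≤ C ∧ ∀ (n : ℕ) [NeZero n] (a : ℝ), aminus ≤ a → a ≤ aplus →
      ∀ (N : Fin (d + 1) → ℕ), (∀ i, 1 ≤ N i) → ∀ (μ ν : Fin (d + 1)) (σ : Fin (d + 1) → ℤ), σ ≠ 0 →
        (∀ i, |σ i| ≤ n) → ∀ (x x'' : Idx (fun i => n * N i)),
          ((n : ℝ) / supNorm σ) ^ α * |dpd n a N μ ν (tsh σ x) x'' - dpd n a N μ ν x x''| ≤
            C * Real.exp (-(δ * MultiPeriod.torusSupNorm N (coarse n (toZ x) - coarse n (toZ x'')))) := by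
  obtain ⟨κ₁, M₁, hκ₁, hM₁, h₁⟩ := DKRe_decay d aminus aplus ha
  obtain ⟨κ₂, M₂, hκ₂, hM₂, h₂⟩ := kerRe_decay d aminus aplus ha
  obtain ⟨κ₃, M₃, hκ₃, hM₃, h₃⟩ := HDKRe_decay d aminus aplus ha hα0 hα1
  have hd1 : (0 : ℝ) < (d : ℝ) + 1 := by positivity
  set r : ℝ := min (min κ₁ κ₂) κ₃ / ((d : ℝ) + 1) with hr_def
  have hr : 0 < r := div_pos (lt_min (lt_min hκ₁ hκ₂) hκ₃) hd1
  have hr₁ : r ≤ κ₁ / ((d : ℝ) + 1) :=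
    div_le_div_of_nonneg_right ((min_le_left _ _).trans (min_le_left _ _)) hd1.le
  have hr₂ : r ≤ κ₂ / ((d : ℝ) + 1) :=
    div_le_div_of_nonneg_right ((min_le_left _ _).trans (min_le_right _ _)) hd1.le
  have hr₃ : r ≤ κ₃ / ((d : ℝ) + 1) := div_le_div_of_nonneg_right (min_le_right _ _) hd1.le
  set A : ℝ := M₁ * periodConst κ₁ d with hA_def
  set B : ℝ := M₂ * periodConst κ₂ d with hB_def
  set H : ℝ := M₃ * periodConst κ₃ d with hH_def
  have hA : 0 ≤ A := mul_nonneg hM₁ (periodConst_nonneg_of_pos hκ₁ d)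
  have hB : 0 ≤ B := mul_nonneg hM₂ (periodConst_nonneg_of_pos hκ₂ d)
  have hH : 0 ≤ H := mul_nonneg hM₃ (periodConst_nonneg_of_pos hκ₃ d)
  have hK2 : 0 ≤ B4Sect5Proof.latticeConst (d + 1) (r / 2) := B4Sect5Proof.latticeConst_nonneg (d + 1) (by positivity)
  have hK4 : 0 ≤ B4Sect5Proof.latticeConst (d + 1) (r / 2 / 2) :=
    B4Sect5Proof.latticeConst_nonneg (d + 1) (by positivity)
  refine ⟨r / 2 / 2, H * B * B4Sect5Proof.latticeConst (d + 1) (r / 2) * A *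
    B4Sect5Proof.latticeConst (d + 1) (r / 2 / 2), by positivity, by positivity, ?_⟩
  intro n _ a ha1 ha2 N hN μ ν σ hσ0 hσn x x''
  -- the three factor bounds, in pv23's torus distance on the unit torus, at the common rate `r`
  have hHD : ∀ k : Idx N, |HDKRe α n a N μ σ x k| ≤ H * Real.exp (-(r * tdist N (cIdx n N x) k)) := by
    intro k
    refine (h₃ n a ha1 ha2 N hN μ σ hσ0 hσn x k).trans ?_
    rw [tdist_eq_torusSupNorm hN, toZ_cIdx]
    apply mul_le_mul_of_nonneg_left _ hH
    apply Real.exp_le_exp.mpr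
    have hT := MultiPeriod.torusSupNorm_nonneg hN (coarse n (toZ x) - toZ k)
    nlinarith
  have hDK : ∀ (z : Idx (fun i => n * N i)) (k : Idx N),
      |DKRe n a N ν z k| ≤ A * Real.exp (-(r * tdist N (cIdx n N z) k)) := by
    intro z k
    refine (h₁ n a ha1 ha2 N hN ν z k).trans ?_
    rw [tdist_eq_torusSupNorm hN, toZ_cIdx]
    apply mul_le_mul_of_nonneg_left _ hA
    apply Real.exp_le_exp.mpr
    have hT := MultiPeriod.torusSupNorm_nonneg hN (coarse n (toZ z) - toZ k)
    nlinarith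
  have hker : ∀ k k' : Idx N, |kerRe n a N k k'| ≤ B * Real.exp (-(r * tdist N k k')) := by
    intro k k'
    refine (h₂ n a ha1 ha2 N hN k k').trans ?_
    rw [tdist_eq_torusSupNorm hN]
    apply mul_le_mul_of_nonneg_left _ hB
    apply Real.exp_le_exp.mpr
    have hT := MultiPeriod.torusSupNorm_nonneg hN (toZ k - toZ k')
    nlinarith
  -- first composition: Hölder quotient of `∂_μ(G′Q′^*)` times `(Q′G′²Q′^*)⁻¹`
  have hconv1 : ∀ y' : Idx N, |(HDKRe α n a N μ σ * kerRe n a N) x y'| ≤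
      H * B * B4Sect5Proof.latticeConst (d + 1) (r / 2) * Real.exp (-(r / 2 * tdist N (cIdx n N x) y')) := by
    intro y'
    rw [Matrix.mul_apply]
    exact conv_decay hN hr _ _ (cIdx n N x) y' (fun y => hHD y) (fun y => hker y y')
  -- second composition: `· (∂_ν(G′Q′^*))ᵀ`
  have hconv2 : |(HDKRe α n a N μ σ * kerRe n a N * (DKRe n a N ν)ᵀ) x x''| ≤
      H * B * B4Sect5Proof.latticeConst (d + 1) (r / 2) * A * B4Sect5Proof.latticeConst (d + 1) (r / 2 / 2) *
        Real.exp (-(r / 2 / 2 * tdist N (cIdx n N x) (cIdx n N x''))) := by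
    rw [Matrix.mul_apply]
    refine conv_decay hN (half_pos hr) _ _ (cIdx n N x) (cIdx n N x'') hconv1 ?_
    intro y'
    rw [Matrix.transpose_apply, tdist_symm hN]
    refine (hDK x'' y').trans ?_
    apply mul_le_mul_of_nonneg_left _ hA
    apply Real.exp_le_exp.mpr
    have ht := mul_nonneg hr.le (tdist_nonneg N (cIdx n N x'') y')
    nlinarith
  rw [tdist_eq_torusSupNorm hN, toZ_cIdx, toZ_cIdx, ← holderQuot_dpd_eq] at hconv2
  have hc : 0 ≤ ((n : ℝ) / supNorm σ) ^ α := Real.rpow_nonneg (div_nonneg (Nat.cast_nonneg n) (supNorm_nonneg σ)) α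
  rwa [abs_mul, abs_of_nonneg hc] at hconv2

/-- **(1.127) IN THE PRINTED FORM — FINE TORUS DISTANCE IN THE EXPONENT**: with `tdist_{T_η}` the sup-distance on the fine torus
counted in fine steps, `(n/|σ|_∞)^α·|dpd(x+σ, x″) − dpd(x, x″)| ≤ C′·e^{−(δ/n)·tdist_{T_η}(x,x″)}`, i.e. `≤ C′e^{−δ|x−x″|}`
with `|x − x″| = η·tdist`; `δ, C′` depend on `d, α, a₋, a₊` only (`tdist_{T_η}(x,x″) ≤ n·|⌊x/n⌋ − ⌊x″/n⌋|_{T₁} + (n − 1)`,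
`B5DPD126Uniform.tdist_fine_le`).  [cite: Balaban1984PropagatorsI, (1.127) p.38; proof supplied by the audit] -/
theorem dpd_holder_uniform_fine (d : ℕ) (aminus aplus : ℝ) (ha : 0 < aminus) {α : ℝ} (hα0 : 0 ≤ α) (hα1 : α < 1) :
    ∃ δ C : ℝ, 0 < δ ∧ 0 ≤ C ∧ ∀ (n : ℕ) [NeZero n] (a : ℝ), aminus ≤ a → a ≤ aplus →
      ∀ (N : Fin (d + 1) → ℕ), (∀ i, 1 ≤ N i) → ∀ (μ ν : Fin (d + 1)) (σ : Fin (d + 1) → ℤ), σ ≠ 0 →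
        (∀ i, |σ i| ≤ n) → ∀ (x x'' : Idx (fun i => n * N i)),
          ((n : ℝ) / supNorm σ) ^ α * |dpd n a N μ ν (tsh σ x) x'' - dpd n a N μ ν x x''| ≤
            C * Real.exp (-(δ / n * tdist (fun i => n * N i) x x'')) := by
  obtain ⟨δ, C, hδ, hC, h⟩ := dpd_holder_uniform d aminus aplus ha hα0 hα1
  refine ⟨δ, C * Real.exp δ, hδ, by positivity, fun n _ a ha1 ha2 N hN μ ν σ hσ0 hσn x x'' => ?_⟩
  refine (h n a ha1 ha2 N hN μ ν σ hσ0 hσn x x'').trans ?_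
  rw [mul_assoc, ← Real.exp_add]
  apply mul_le_mul_of_nonneg_left _ hC
  apply Real.exp_le_exp.mpr
  have hn : (0 : ℝ) < n := by exact_mod_cast NeZero.pos n
  have ht := tdist_fine_le n hN x x''
  have hT := MultiPeriod.torusSupNorm_nonneg hN (coarse n (toZ x) - coarse n (toZ x''))
  have htd := tdist_nonneg (fun i => n * N i) x x''
  have h1 : δ / n * tdist (fun i => n * N i) x x''
      ≤ δ * MultiPeriod.torusSupNorm N (coarse n (toZ x) - coarse n (toZ x'')) + δ := by
    rw [div_mul_eq_mul_div, div_le_iff₀ hn]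
    have := mul_le_mul_of_nonneg_left ht hδ.le
    nlinarith
  linarith

/-- **THE SIDE CONDITION AND THE WEIGHT OF (1.127) IN THE DICTIONARY**: for `σ ≠ 0` with `|σ_i| ≤ n` the separation
`|x − x′|_∞ = |σ|_∞/n` lies in `(0, 1]` — the printed «for x, x′: |x − x′| ≦ 1» — and `(n/|σ|_∞)^α = (|σ|_∞/n)^{−α}` is the
printed weight `1/|x − x′|^α`.  [cite: Balaban1984PropagatorsI, (1.127) p.38 (side condition)] -/
theorem separation_mem_Ioc (n : ℕ) [NeZero n] {σ : Fin (d + 1) → ℤ} (hσ0 : σ ≠ 0) (hσn : ∀ i, |σ i| ≤ n) :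
    supNorm σ / n ∈ Set.Ioc (0 : ℝ) 1 ∧ ∀ α : ℝ, ((n : ℝ) / supNorm σ) ^ α = (supNorm σ / n) ^ (-α) := by
  have hn : (0 : ℝ) < n := by exact_mod_cast NeZero.pos n
  have h1 : (1 : ℝ) ≤ supNorm σ := one_le_supNorm hσ0
  have hle : supNorm σ ≤ n := by
    unfold supNorm
    refine Finset.sup'_le _ _ fun i _ => ?_
    exact_mod_cast hσn i
  refine ⟨⟨by positivity, (div_le_one hn).mpr hle⟩, fun α => ?_⟩
  rw [Real.rpow_neg (by positivity), ← Real.inv_rpow (by positivity), inv_div]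

end

end Literature.MathematicalPhysics.QuantumFieldTheory.Balaban1983to89.B5DPD127HolderUniform
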